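import Literature.NumberTheory.EllipticCurves.HeegnerPointsKolyvaginPairing
import HarnessLib

/-!
# Route `PrintCFram`, crux C2 `BottomClassIndexLawFiveLe` (stmt-BirchSwinnertonDyer-20372), line
# `eisenstein-resource-bdp-line` (S2 `stub_kolyvaginUpper_borelCM_pairSum`, input (γ)):
# **the BOREL / UNISERIAL variant of Gross 1991, Prop. 9.3** — joint surjectivity of the
# Kolyvagin evaluations when `E[p]` is NOT simple but has a unique stable line
# (cell `bsd-print-cfram`, seat `bsd-line-cfram-p1-w2` g5; helper `--supports` 20372; 0 facts, 0 defs)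

HONEST FRAMING. Nothing about BSD is proved here, and nothing of S2 itself. The tree's Kolyvagin
machine consumes Gross's Prop. 9.3 (`KolyvaginPairing.eq_top_of_stable_of_indep`,
`exists_h1Eval_eq`) under two hypotheses — `E[p]` a SIMPLE `Γ_K`-module (`hS`) with SCALAR commutant
(`hC`) — and both are what `HasSurjectiveModNGaloisRep` supplies at a good ordinary prime. At the
Borel CM-ramified prime of the class (`p ∣ d_K`, `p ≥ 5`) `E[p]` is reducible: the isogeny kernel
`L = E[𝔭]` is a `Γ_ℚ`-stable line, `hS` is false, and Prop. 9.3 AS STATED is false too — for `r = 1`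
the `Γ`-stable subgroup `M = L ≤ E[p]` has independent coordinate functional (`a·m = 0` on `L` forces
`p ∣ a`) without being `E[p]`. This file proves the replacement that IS true and says exactly what
the `𝓞_𝔭`-bookkeeping of S2 must supply:

* §1 `eq_top_of_stable_of_indep_modLine` (abstract, the currency of
  `KolyvaginPairing.eq_top_of_stable_of_indep`): `G ↷ T` finite, `L ≤ T` a `G`-stable subgroup with
  `T/L` cyclic, and every `G`-stable subgroup of `T` is `⊥`, `L` or `⊤` (a UNISERIAL module of
  length two — NO commutant hypothesis); then every `G`-stable `M ≤ T^r` whose coordinate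
  functionals are independent MODULO `L` (`∑ aᵢ mᵢ ∈ L` on `M ⟹ p ∣ aᵢ`) is all of `T^r`.
  Proof: Gross's induction on `r`; the fibre of `M` over `T^r` is `⊥`, `L` or `⊤`; if it is `≤ L`
  the last coordinate is, modulo `L`, an additive `G`-equivariant function `Ψ : T^r → T/L` of the
  others; each partial map `T → T/L` has `G`-stable kernel, which is `L` or `⊤` (it cannot be `⊥`:
  `#T > #(T/L)`), so factors through the cyclic `T/L` and is an integer scalar `cⱼ`; then
  `m_last − ∑ cⱼ mⱼ ∈ L` on `M`, a forbidden relation with coefficient `−1`.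
* §2 `exists_h1Eval_eq_of_indep_modLine` (any field `K`, any Weierstrass curve, the tree's
  `h1Eval` / `torsionFixing` / `jointRange`): for classes `x₁, …, x_r ∈ H¹(K, E[p])` whose
  evaluations are independent modulo `L` — `∑ aᵢ [xᵢ, ρ] ∈ L` for all `ρ ∈ Γ_{K(E[p])}` forces
  `p ∣ aᵢ` — every `(eᵢ) ∈ E[p]^r` is `([xᵢ, ρ])ᵢ` for some `ρ ∈ Γ_{K(E[p])}`. (No Prop. 9.1 and no
  `−1 ∈ image` is needed in this form: the independence is already on `Γ_{K(E[p])}`.)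
  `exists_h1Eval_eq_of_not_mem` records the case `r = 1`: a class with SOME evaluation outside
  `L` has ALL of `E[p]` as values (a class with all values in `L` — e.g. inflated from `H¹(K, L)` —
  has image `L`; this is the Borel phenomenon the plain statement cannot see).

The leaf discharge of the three hypotheses for `T = W[p]`, `L = W[𝔭]`, `G = Γ_{K''}` (every
quadratic `K''`, including `ℚ(√−p)`), in both currencies, is the sequel `…BorelGrossSurjectivityLeaf.lean`.
THEOREMS ONLY; no definition, no named fact, no `sorry`. BSD is not proved by any of this; no summit
statement is proved by this seat.
References: [GrossLMS1991] §9 Prop. 9.3 (PDF pp. 227–228 of the held volume); [McCallumLMS1991] §3 (2).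
-/

set_option autoImplicit false
-- `…BirchSwinnertonDyer.BirchSwinnertonDyer.Theorems…` is the problem's mandated namespace (D-0017).
set_option linter.dupNamespace false

noncomputable section

open scoped Classical

namespace Summit.BirchSwinnertonDyer.BirchSwinnertonDyer.Theorems.PrintCFram.BorelKolyvaginPairing

open WeierstrassCurve Field Literature.NumberTheory.EllipticCurves
  Literature.NumberTheory.EllipticCurves.KolyvaginPairing Literature.NumberTheory.GaloisRepresentations

universe u

/-! ## §1 The uniserial variant of `KolyvaginPairing.eq_top_of_stable_of_indep` -/

section Abstract

variable {G : Type*} [Group G] {T : Type*} [AddCommGroup T] [DistribMulAction G T]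

omit [DistribMulAction G T] in
/-- **A homomorphism into a cyclic quotient that kills `L` is an integer scalar.** If `T/L` is
generated by the class of `t₀` (`∀ t, ∃ k, t − k t₀ ∈ L`) and `ψ : T →+ T/L` vanishes on `L`, then
`ψ t = c · (t mod L)` for one integer `c`. [folklore] -/
theorem exists_eq_zsmul_mk_of_cyclic (L : AddSubgroup T) {t₀ : T}
    (hcyc : ∀ t : T, ∃ k : ℤ, t - k • t₀ ∈ L) (ψ : T →+ T ⧸ L) (hψ : ∀ t ∈ L, ψ t = 0) :
    ∃ c : ℤ, ∀ t, ψ t = c • (QuotientAddGroup.mk' L t) := by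
  -- `ψ t₀ = c · (t₀ mod L)`
  obtain ⟨u, hu⟩ := QuotientAddGroup.mk'_surjective L (ψ t₀)
  obtain ⟨c, hc⟩ := hcyc u
  have ht₀ : ψ t₀ = c • QuotientAddGroup.mk' L t₀ := by
    rw [← hu, ← map_zsmul, QuotientAddGroup.mk'_apply, QuotientAddGroup.mk'_apply,
      QuotientAddGroup.eq_iff_sub_mem]
    exact hc
  refine ⟨c, fun t => ?_⟩
  obtain ⟨k, hk⟩ := hcyc t
  have ht : t = k • t₀ + (t - k • t₀) := by abel
  have hmk : QuotientAddGroup.mk' L t = k • QuotientAddGroup.mk' L t₀ := by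
    rw [← map_zsmul, QuotientAddGroup.mk'_apply, QuotientAddGroup.mk'_apply,
      QuotientAddGroup.eq_iff_sub_mem]
    exact hk
  rw [hmk]
  conv_lhs => rw [ht, map_add, hψ _ hk, add_zero, map_zsmul, ht₀]
  exact smul_comm _ _ _

omit [DistribMulAction G T] in
/-- **Counting.** For finite `T` and `L ≠ ⊥` no homomorphism `T →+ T/L` is injective
(`#T = #(T/L)·#L > #(T/L)`); so a homomorphism `ψ : T →+ T/L` whose kernel is `⊥`, `L` or `⊤`
vanishes on `L`. [folklore] -/
theorem le_ker_of_ker_trichotomy [Finite T] (L : AddSubgroup T) (ψ : T →+ T ⧸ L)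
    (hK : ψ.ker = ⊥ ∨ ψ.ker = L ∨ ψ.ker = ⊤) : L ≤ ψ.ker := by
  rcases hK with hbot | hL | htop
  · by_cases hL0 : L = ⊥
    · intro t ht
      rw [hL0, AddSubgroup.mem_bot] at ht
      rw [ht]
      exact zero_mem _
    · exfalso
      have hinj : Function.Injective ψ := (AddMonoidHom.ker_eq_bot_iff ψ).mp hbot
      have hle : Nat.card T ≤ Nat.card (T ⧸ L) := Nat.card_le_card_of_injective ψ hinj
      have hmul : Nat.card T = Nat.card (T ⧸ L) * Nat.card L :=
        AddSubgroup.card_eq_card_quotient_mul_card_addSubgroup L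
      have hLc : 1 < Nat.card L := (AddSubgroup.one_lt_card_iff_ne_bot L).mpr hL0
      have hQ : 0 < Nat.card (T ⧸ L) := Nat.card_pos
      nlinarith
  · exact hL.symm.le
  · rw [htop]; exact le_top

/-- **Gross 1991, Prop. 9.3 — uniserial variant.** Let `G` act on the finite `T`, let `L ≤ T` be a
`G`-stable subgroup with `T/L` cyclic (generated by `t₀ mod L`), and suppose every `G`-stable
subgroup of `T` is `⊥`, `L` or `⊤` (no commutant hypothesis). Let `p` be a prime. Then a
`G`-stable subgroup `M ≤ T^r` whose coordinate functionals are independent MODULO `L` — every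
relation `∑ aᵢ mᵢ ∈ L` on `M` has all `aᵢ ≡ 0 (mod p)` — is all of `T^r`. (For simple `T` take
`L = ⊥`… except that then `T` itself must be cyclic; the simple case is the tree's
`KolyvaginPairing.eq_top_of_stable_of_indep`, which needs the scalar commutant instead. At a Borel
prime plain independence is not enough: `M = L`, `r = 1`.) Induction on `r` as in Gross's proof;
in the new case "fibre `≤ L`" the last coordinate is an additive `G`-map `T^r → T/L` of the others
modulo `L`, each of whose partial maps has `G`-stable kernel `⊇ L` (`le_ker_of_ker_trichotomy`) and
is therefore an integer scalar on the cyclic `T/L` (`exists_eq_zsmul_mk_of_cyclic`).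
[cite: GrossLMS1991, Prop. 9.3 (proof)] -/
theorem eq_top_of_stable_of_indep_modLine {p : ℕ} (hp : p.Prime) [Finite T] (L : AddSubgroup T)
    (hL : ∀ g : G, ∀ t ∈ L, g • t ∈ L) {t₀ : T} (hcyc : ∀ t : T, ∃ k : ℤ, t - k • t₀ ∈ L)
    (hS : ∀ H : AddSubgroup T, (∀ g : G, ∀ t ∈ H, g • t ∈ H) → H = ⊥ ∨ H = L ∨ H = ⊤) :
    ∀ (r : ℕ) (M : AddSubgroup (Fin r → T)), (∀ g : G, ∀ m ∈ M, g • m ∈ M) →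
      (∀ a : Fin r → ℤ, (∀ m ∈ M, (∑ i, a i • m i) ∈ L) → ∀ i, (p : ℤ) ∣ a i) → M = ⊤ := by
  intro r
  induction r with
  | zero =>
    intro M _ _
    exact eq_top_iff.mpr fun m _ ↦ by rw [Subsingleton.elim m 0]; exact zero_mem M
  | succ r ih =>
    intro M hstab hind
    -- the projection `M'` of `M` to the first `r` coordinates is everything
    set M' := M.map (initHom T r) with hM'
    have hM'top : M' = ⊤ := by
      refine ih M' (fun g m' hm' ↦ ?_) (fun a ha i ↦ ?_)
      · obtain ⟨m, hm, rfl⟩ := hm'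
        exact ⟨g • m, hstab g m hm, rfl⟩
      · have h := hind (Fin.snoc a 0) (fun m hm ↦ ?_) (Fin.castSucc i)
        · simpa using h
        · rw [Fin.sum_univ_castSucc]
          simp only [Fin.snoc_castSucc, Fin.snoc_last, zero_smul, add_zero]
          have := ha (initHom T r m) ⟨m, hm, rfl⟩
          simpa using this
    have hsurj : ∀ y : Fin r → T, ∃ m ∈ M, initHom T r m = y := fun y ↦ by
      have hy : y ∈ M' := by rw [hM'top]; trivial
      obtain ⟨m, hm, hmy⟩ := hy
      exact ⟨m, hm, hmy⟩
    -- the fibre `N` of `M` over `0`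
    set N : AddSubgroup T := M.comap (AddMonoidHom.single (fun _ : Fin (r + 1) ↦ T) (Fin.last r))
      with hN
    have hNmem : ∀ t, t ∈ N ↔ (Pi.single (Fin.last r) t : Fin (r + 1) → T) ∈ M := fun t ↦ Iff.rfl
    have hNstab : ∀ g : G, ∀ t ∈ N, g • t ∈ N := fun g t ht ↦ by
      rw [hNmem] at ht ⊢
      rw [← smul_single_last]
      exact hstab g _ ht
    have hcases : N ≤ L ∨ N = ⊤ := by
      rcases hS N hNstab with h | h | h
      · exact Or.inl (h ▸ bot_le)
      · exact Or.inl h.le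
      · exact Or.inr h
    rcases hcases with hNL | htop
    · -- `N ≤ L`: modulo `L`, the last coordinate is a `G`-linear function of the others
      exfalso
      have hlast : ∀ m ∈ M, ∀ m₁ ∈ M, initHom T r m₁ = initHom T r m →
          m (Fin.last r) - m₁ (Fin.last r) ∈ L := by
        intro m hm m₁ hm₁ h
        have hd : m - m₁ ∈ M := M.sub_mem hm hm₁
        have h0 : initHom T r (m - m₁) = 0 := by rw [map_sub, h, sub_self]
        rw [eq_single_of_initHom_eq_zero h0] at hd
        exact hNL ((hNmem _).mpr hd)
      -- the function `F y = (some lift of y) (last)`, well defined and additive modulo `L`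
      set F : (Fin r → T) → T := fun y ↦ (Classical.choose (hsurj y)) (Fin.last r) with hF
      have hFspec : ∀ m ∈ M, F (initHom T r m) - m (Fin.last r) ∈ L := fun m hm ↦ by
        obtain ⟨hm₁, h₁⟩ := Classical.choose_spec (hsurj (initHom T r m))
        have := hlast _ hm₁ m hm h₁.symm
        exact this
      have hFadd : ∀ y y', F (y + y') - (F y + F y') ∈ L := fun y y' ↦ by
        obtain ⟨m, hm, rfl⟩ := hsurj y
        obtain ⟨m', hm', rfl⟩ := hsurj y'
        have h := L.sub_mem (L.sub_mem (hFspec _ (M.add_mem hm hm')) (hFspec _ hm)) (hFspec _ hm')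
        rw [← map_add]
        convert h using 1
        simp only [Pi.add_apply]
        abel
      have hFsmul : ∀ (g : G) y, F (g • y) - g • F y ∈ L := fun g y ↦ by
        obtain ⟨m, hm, rfl⟩ := hsurj y
        have hgm : g • initHom T r m = initHom T r (g • m) := rfl
        have h := L.sub_mem (hFspec _ (hstab g m hm)) (hL g _ (hFspec _ hm))
        rw [hgm]
        convert h using 1
        rw [smul_sub, Pi.smul_apply]
        abel
      -- `Ψ y = F y mod L`, an additive map `T^r → T/L`
      let Ψ : (Fin r → T) →+ T ⧸ L :=
        { toFun := fun y ↦ QuotientAddGroup.mk' L (F y)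
          map_zero' := by
            have h := hFspec 0 M.zero_mem
            rw [map_zero, Pi.zero_apply, sub_zero] at h
            exact (QuotientAddGroup.eq_zero_iff _).mpr h
          map_add' := fun y y' ↦ by
            rw [← map_add, QuotientAddGroup.mk'_apply, QuotientAddGroup.mk'_apply,
              QuotientAddGroup.eq_iff_sub_mem]
            exact hFadd y y' }
      have hΨ : ∀ y, Ψ y = QuotientAddGroup.mk' L (F y) := fun _ ↦ rfl
      -- each partial map `t ↦ Ψ (single j t)` kills `L`, hence is an integer scalar `c j`
      have hc : ∀ j : Fin r, ∃ c : ℤ, ∀ t, Ψ (Pi.single j t) = c • QuotientAddGroup.mk' L t := by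
        intro j
        set ψ : T →+ T ⧸ L := Ψ.comp (AddMonoidHom.single (fun _ : Fin r ↦ T) j) with hψ
        have hψapp : ∀ t, ψ t = Ψ (Pi.single j t) := fun _ ↦ rfl
        have hker : ∀ t, t ∈ ψ.ker ↔ F (Pi.single j t) ∈ L := fun t ↦ by
          rw [AddMonoidHom.mem_ker, hψapp, hΨ, QuotientAddGroup.mk'_apply,
            QuotientAddGroup.eq_zero_iff]
        have hkstab : ∀ g : G, ∀ t ∈ ψ.ker, g • t ∈ ψ.ker := fun g t ht ↦ by
          rw [hker] at ht ⊢
          have h := L.add_mem (hFsmul g (Pi.single j t)) (hL g _ ht)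
          rw [smul_single, sub_add_cancel] at h
          exact h
        have hLk : L ≤ ψ.ker := le_ker_of_ker_trichotomy L ψ (hS _ hkstab)
        obtain ⟨c, hc⟩ := exists_eq_zsmul_mk_of_cyclic L hcyc ψ
          (fun t ht ↦ (AddMonoidHom.mem_ker).mp (hLk ht))
        exact ⟨c, fun t ↦ by rw [← hψapp, hc]⟩
      choose c hc using hc
      -- hence `Ψ y = (∑ c j • y j) mod L`
      have hΨsum : ∀ y, Ψ y = QuotientAddGroup.mk' L (∑ j : Fin r, c j • y j) := fun y ↦ by
        conv_lhs => rw [show y = ∑ j : Fin r, Pi.single j (y j) from (Finset.univ_sum_single _).symm]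
        rw [map_sum Ψ, map_sum]
        exact Finset.sum_congr rfl fun j _ ↦ by rw [hc, map_zsmul]
      -- the forbidden relation `m_last - ∑ c j • m j ∈ L`, coefficient `1` in the last coordinate
      refine hp.one_lt.ne' (Nat.dvd_one.mp ?_)
      have h := hind (Fin.snoc (fun j ↦ -c j) 1) (fun m hm ↦ ?_) (Fin.last r)
      · rw [Fin.snoc_last] at h
        exact_mod_cast h
      · rw [Fin.sum_univ_castSucc]
        simp only [Fin.snoc_castSucc, Fin.snoc_last, neg_smul, one_smul, Finset.sum_neg_distrib]
        -- `m last ≡ F (init m) ≡ ∑ c j • m j (mod L)`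
        have h1 : F (initHom T r m) - ∑ j : Fin r, c j • m j.castSucc ∈ L := by
          rw [← QuotientAddGroup.eq_iff_sub_mem, ← QuotientAddGroup.mk'_apply,
            ← QuotientAddGroup.mk'_apply, ← hΨ, hΨsum]
          rfl
        have h2 := L.sub_mem h1 (hFspec m hm)
        convert h2 using 1
        abel
    · -- `N = ⊤`: `M` contains the last coordinate axis and surjects onto the rest
      refine eq_top_iff.mpr fun m₀ _ ↦ ?_
      obtain ⟨m, hm, h⟩ := hsurj (initHom T r m₀)
      rw [eq_add_single_of_initHom_eq h]
      refine M.add_mem hm ((hNmem _).mp ?_)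
      rw [htop]; trivial

end Abstract

/-! ## §2 The cohomological form: joint surjectivity of `ρ ↦ ([xᵢ, ρ])ᵢ` modulo a line -/

section Surjective

variable {K : Type u} [Field K] (W : WeierstrassCurve K) {p : ℕ}

/-- **Gross 1991, Prop. 9.3 / McCallum (2) at a uniserial `E[p]`.** Let `L ≤ E[p]` be a
`Γ_K`-stable subgroup with `E[p]/L` cyclic such that every `Γ_K`-stable subgroup of `E[p]` is
`⊥`, `L` or `⊤`. If the classes `x₁, …, x_r ∈ H¹(K, E[p])` have evaluations independent modulo `L`
— `∑ aᵢ [xᵢ, ρ] ∈ L` for every `ρ ∈ Γ_{K(E[p])}` forces `p ∣ aᵢ` for all `i` — then for any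
`e₁, …, e_r ∈ E[p]` there is `ρ ∈ Γ_{K(E[p])}` with `[xᵢ, ρ] = eᵢ` for all `i`: the map
`Gal(K̄/K(E[p])) → E[p]^r`, `ρ ↦ ([xᵢ, ρ])ᵢ`, is onto (Gross's `Gal(L_S/L) ⥲ Hom(S, E_p)`).
`eq_top_of_stable_of_indep_modLine` applied to the tree's `jointRange`. [cite: GrossLMS1991, Prop. 9.3]
[cite: McCallumLMS1991, §3 (2)] -/
theorem exists_h1Eval_eq_of_indep_modLine (hp : p.Prime) [Finite (geomTorsion W p)]
    (L : AddSubgroup (geomTorsion W p)) (hL : ∀ g : absoluteGaloisGroup K, ∀ t ∈ L, g • t ∈ L)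
    {t₀ : geomTorsion W p} (hcyc : ∀ t : geomTorsion W p, ∃ k : ℤ, t - k • t₀ ∈ L)
    (hS : ∀ H : AddSubgroup (geomTorsion W p), (∀ g : absoluteGaloisGroup K, ∀ t ∈ H, g • t ∈ H) →
      H = ⊥ ∨ H = L ∨ H = ⊤)
    {r : ℕ} (xs : Fin r → galH1Torsion W p)
    (hind : ∀ a : Fin r → ℤ,
      (∀ ρ ∈ torsionFixing W p, (∑ i, a i • h1Eval W p (xs i) ρ) ∈ L) → ∀ i, (p : ℤ) ∣ a i)
    (e : Fin r → geomTorsion W p) :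
    ∃ ρ ∈ torsionFixing W p, ∀ i, h1Eval W p (xs i) ρ = e i := by
  have htop := eq_top_of_stable_of_indep_modLine hp L hL hcyc hS r (jointRange W xs)
    (fun g m hm ↦ smul_mem_jointRange W xs g hm) (fun a ha i ↦ ?_)
  · have : e ∈ jointRange W xs := by rw [htop]; trivial
    exact this
  · exact hind a (fun ρ hρ ↦ ha _ ⟨ρ, hρ, fun i ↦ rfl⟩) i

/-- **The case `r = 1`.** Under the same hypotheses on `E[p]`: a class `x ∈ H¹(K, E[p])` with one
evaluation `[x, ρ₀] ∉ L` takes EVERY value of `E[p]` on `Γ_{K(E[p])}` — the restriction of `x` to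
`Γ_{K(E[p])}` is onto `E[p]` (whereas a class with all values in `L`, e.g. one inflated from
`H¹(K, L)`, has image `L`: the Borel phenomenon plain Prop. 9.3 cannot see). Needs `p·E[p] = 0`
to reduce `a [x, ρ₀] ∈ L`, `p ∤ a`, to `[x, ρ₀] ∈ L`. [cite: GrossLMS1991, Prop. 9.3] -/
theorem exists_h1Eval_eq_of_not_mem (hp : p.Prime) [Finite (geomTorsion W p)]
    (L : AddSubgroup (geomTorsion W p)) (hL : ∀ g : absoluteGaloisGroup K, ∀ t ∈ L, g • t ∈ L)
    {t₀ : geomTorsion W p} (hcyc : ∀ t : geomTorsion W p, ∃ k : ℤ, t - k • t₀ ∈ L)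
    (hS : ∀ H : AddSubgroup (geomTorsion W p), (∀ g : absoluteGaloisGroup K, ∀ t ∈ H, g • t ∈ H) →
      H = ⊥ ∨ H = L ∨ H = ⊤)
    (hpT : ∀ t : geomTorsion W p, (p : ℤ) • t = 0)
    (x : galH1Torsion W p) {ρ₀ : absoluteGaloisGroup K} (hρ₀ : ρ₀ ∈ torsionFixing W p) (hx : h1Eval W p x ρ₀ ∉ L)
    (e : geomTorsion W p) : ∃ ρ ∈ torsionFixing W p, h1Eval W p x ρ = e := by
  have hp' : _root_.Prime (p : ℤ) := Nat.prime_iff_prime_int.mp hp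
  -- `a₀ [x, ρ₀] ∈ L` with `p ∤ a₀` would put `[x, ρ₀]` in `L` (Bezout, `p·E[p] = 0`)
  have hind : ∀ a : Fin 1 → ℤ,
      (∀ ρ ∈ torsionFixing W p, (∑ i, a i • h1Eval W p ((fun _ : Fin 1 ↦ x) i) ρ) ∈ L) →
        ∀ i, (p : ℤ) ∣ a i := by
    intro a ha i
    have ha0 : a 0 • h1Eval W p x ρ₀ ∈ L := by
      have := ha ρ₀ hρ₀
      simpa using this
    obtain rfl : i = 0 := Subsingleton.elim i 0
    by_contra hnd
    have hcop : IsCoprime (p : ℤ) (a 0) := (Prime.coprime_iff_not_dvd hp').mpr hnd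
    obtain ⟨v, u, huv⟩ := hcop
    apply hx
    have : h1Eval W p x ρ₀ = u • (a 0 • h1Eval W p x ρ₀) + v • ((p : ℤ) • h1Eval W p x ρ₀) := by
      rw [smul_smul, smul_smul, ← add_smul, add_comm, huv, one_smul]
    rw [this, hpT, smul_zero, add_zero]
    exact L.zsmul_mem ha0 u
  obtain ⟨ρ, hρ, h⟩ := exists_h1Eval_eq_of_indep_modLine W hp L hL hcyc hS (fun _ ↦ x) hind
    (fun _ ↦ e)
  exact ⟨ρ, hρ, h 0⟩

end Surjective

end Summit.BirchSwinnertonDyer.BirchSwinnertonDyer.Theorems.PrintCFram.BorelKolyvaginPairing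

end
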